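import Literature.AnabelianGeometry.SemiGraphs.GaloisCountableUniformity
import Literature.AnabelianGeometry.SemiGraphs.CoveringGraphTempered
import HarnessLib

/-!
# `UniformSplitting` and Proposition 3.6 (v) for EVERY coherent `G` (as in Proposition 3.6)

Mochizuki, *Semi-graphs of anabelioids*, Publ. RIMS **42** (2006), proof of Prop. 3.6 (v) p. 40
[cite: MochizukiSemiAnbd2006, Prop 3.6(v) p.40]: "it suffices to show that the composite of any
tempered covering `H' → G'` with the given tempered covering `G' → G` forms a tempered covering
`H' → G`; moreover … we may assume without loss of generality that the covering `H' → G'` is finite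
étale. But then it follows from the coherence of `G` [cf. Definition 2.3, (iii)] that there exists a
finite étale covering `H~ → G` whose pull-back to `G'` splits the restrictions of `H' → G'` to each of
the `G'_c`", read with the Galois-countability hypothesis that the author's erratum [IUTchI]
Rmk. 2.5.3 (ii) (E7) adds to [SemiAnbd] 3.5–3.9 [cite: Mochizuki2012, IUTchI Rem. 2.5.3(ii)(E7) p.54].

PROOF-ONLY companion (no definitions; statement files untouched). The tree had the named fact
`UniformSplitting` (= the displayed sentence, `TemperedReconstruction.lean`) PROVED for strictly
coherent `G` ([IUTchI] Rmk. 2.5.3 (i) (T3)/(T4); `uniformSplittingAt_of_isStrictlyCoherent`): there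
"coherence" gives, uniformly in the component `c`, an open subgroup `U_c ⊆ Π_c` of BOUNDED index
inside every open subgroup of index `≤ K`, and quasi-coherence (Def. 2.3 (iii)) turns the family
`Π_c/U_c` into one finite étale covering of `G`. For a general coherent `G` (each `Π_c` topologically
finitely generated, no uniform bound) the uniformity is supplied by Galois-countability (T2) through
the diagonal argument of `GaloisCountableUniformity.lean` (`exists_uniform_fixator_V` / `_E`): off a
FINITE set of components one finite étale covering `F_i` of `G` is already deep enough at index
`≤ K`; on the finitely many exceptional components the (T4) subgroups of the topologically finitely
generated `Π_c` are used as before. Results: `uniformSplittingAt_of_isCoherent`,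
**`uniformSplitting_holds : UniformSplitting`**, **`etaleOfTemperedCovering_holds :
EtaleOfTemperedCovering`** — [SemiAnbd] Prop. 3.6 (v) (`B^temp(G_S) ≌ B^temp(G)_S`) for every `G` as in
Prop. 3.6 that is coherent — and the sorite "tempered over `G_S` ⇒ tempered over `G`"
(`isTempered_of_toCovering'`) unconditionally. No statement of the paper is strengthened; nothing
here takes a side on [IUTchIII] Cor. 3.12.
-/

noncomputable section

open CategoryTheory Topology

namespace Literature.AnabelianGeometry.SemiGraphs

open Literature.AnabelianGeometry.AbsoluteAnabelian.IsTopologicallyFinitelyGenerated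
  (exists_open_normal_le_ker)

universe u

namespace ProfiniteSemiGraph

variable {𝒢 : ProfiniteSemiGraph.{u}}

/-! ### 3. `UniformSplitting` at every tempered `S` over a coherent `G` -/

namespace CovObj

variable (S : CovObj 𝒢)

/-- **`UniformSplitting` holds at every tempered `S` over every coherent `G`** (as in Prop. 3.6):
the covering-construction step of the proof of [SemiAnbd] Prop. 3.6 (v) (p. 40) — the argument of
`uniformSplittingAt_of_isStrictlyCoherent` with the uniform (T4) bound replaced, off finitely many
components, by the (T2)-uniform pointwise stabilisers of `exists_uniform_fixator_V` / `_E` and, on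
the finitely many exceptional components, by the (T4) subgroups of the topologically finitely
generated `Π_c` (coherence). [cite: MochizukiSemiAnbd2006, Prop 3.6(v) p.40] -/
theorem uniformSplittingAt_of_isCoherent (h36 : 𝒢.Prop36Hypotheses) (hcoh : 𝒢.IsCoherent)
    (hS : S.IsTempered) : S.UniformSplittingAt := by
  classical
  intro H hH p
  haveI : ∀ v', Finite (H.SV v').obj.V := hH.finite_V
  haveI : ∀ e', Finite (H.SE e').obj.V := hH.finite_E
  obtain ⟨-, hgenV, hgenE⟩ := hcoh
  -- `F₀` splitting the component of `S` under `p`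
  obtain ⟨F₀, h0fin, h0ne, h0split⟩ := hS (S.nodeBase (S.idxNode H p))
  haveI : ∀ v, Finite (F₀.SV v).obj.V := h0fin.finite_V
  haveI : ∀ e, Finite (F₀.SE e).obj.V := h0fin.finite_E
  -- the degrees
  obtain ⟨v₀⟩ := h36.hasVertex
  let D : ℕ := F₀.nodeCard (Sum.inl v₀)
  have hD : ∀ n : 𝒢.graph.Node, F₀.nodeCard n = D := fun n =>
    F₀.nodeCard_eq_of_reachable (h36.isConnected.connected.preconnected n (Sum.inl v₀))
  let d : ℕ := H.nodeCard (S.idxNode H p)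
  have hd : ∀ q : H.Point, H.SameComponent p q → H.nodeCard (S.idxNode H q) = d := fun q hq =>
    (H.nodeCard_eq_of_reachable (S.reachable_idxNode H hq)).symm
  let K : ℕ := D * d.factorial
  -- (T2)-uniformity at level `K`: the finite coverings `F₁`, `F₂` and their finite exceptional sets
  obtain ⟨F₁, h1fin, h1ne, hEV⟩ := exists_uniform_fixator_V h36.isQuasiCoherent h36.isGaloisCountable K
  obtain ⟨F₂, h2fin, h2ne, hEE⟩ := exists_uniform_fixator_E h36.isQuasiCoherent h36.isGaloisCountable K
  haveI : ∀ v, Finite (F₁.SV v).obj.V := h1fin.finite_V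
  haveI : ∀ e, Finite (F₁.SE e).obj.V := h1fin.finite_E
  haveI : ∀ v, Finite (F₂.SV v).obj.V := h2fin.finite_V
  haveI : ∀ e, Finite (F₂.SE e).obj.V := h2fin.finite_E
  let D₁ : ℕ := F₁.nodeCard (Sum.inl v₀)
  have hD₁ : ∀ n : 𝒢.graph.Node, F₁.nodeCard n = D₁ := fun n =>
    F₁.nodeCard_eq_of_reachable (h36.isConnected.connected.preconnected n (Sum.inl v₀))
  let D₂ : ℕ := F₂.nodeCard (Sum.inl v₀)
  have hD₂ : ∀ n : 𝒢.graph.Node, F₂.nodeCard n = D₂ := fun n =>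
    F₂.nodeCard_eq_of_reachable (h36.isConnected.connected.preconnected n (Sum.inl v₀))
  -- (T4) on the exceptional components: topological generators and their bounds
  choose sV hsV using hgenV
  choose sE hsE using hgenE
  let βV : 𝒢.graph.Vertex → ℕ := fun v => (K.factorial) ^ ((K.factorial) ^ (sV v).card)
  let βE : 𝒢.graph.Edge → ℕ := fun e => (K.factorial) ^ ((K.factorial) ^ (sE e).card)
  let B : ℕ := max (max D₁.factorial D₂.factorial) (max (hEV.toFinset.sup βV) (hEE.toFinset.sup βE))
  -- the uniform open subgroups `U_v`, `U_e`: of index `≤ B`, inside every open subgroup of index `≤ K`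
  have hUV : ∀ v : 𝒢.graph.Vertex, ∃ U : Subgroup (𝒢.Gv v), IsOpen (U : Set (𝒢.Gv v)) ∧
      U.index ≠ 0 ∧ U.index ≤ B ∧
      ∀ N : Subgroup (𝒢.Gv v), IsOpen (N : Set (𝒢.Gv v)) → N.index ≠ 0 → N.index ≤ K → U ≤ N := by
    intro v
    by_cases hv : v ∈ {v : 𝒢.graph.Vertex | ∃ N : Subgroup (𝒢.Gv v), IsOpen (N : Set (𝒢.Gv v)) ∧
        N.index ≠ 0 ∧ N.index ≤ K ∧ ¬ fixator (F₁.SV v) ≤ N}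
    · obtain ⟨U, -, hUo, hUi, hUβ, hUker⟩ := exists_open_normal_le_ker (sV v) (hsV v) K
      refine ⟨U, hUo, hUi, hUβ.trans ?_, fun N hNo hNi hNK => le_of_index_le U hUker N hNo hNi hNK⟩
      calc βV v ≤ hEV.toFinset.sup βV := Finset.le_sup (f := βV) (hEV.mem_toFinset.mpr hv)
        _ ≤ B := le_max_of_le_right (le_max_left _ _)
    · refine ⟨fixator (F₁.SV v), isOpen_fixator _, index_fixator_ne_zero _, ?_,
        fun N hNo hNi hNK => ?_⟩
      · have h1v : Nat.card (F₁.SV v).obj.V = D₁ := hD₁ (Sum.inl v)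
        calc (fixator (F₁.SV v)).index ≤ (Nat.card (F₁.SV v).obj.V).factorial := index_fixator_le _
          _ = D₁.factorial := by rw [h1v]
          _ ≤ B := le_max_of_le_left (le_max_left _ _)
      · by_contra hle
        exact hv ⟨N, hNo, hNi, hNK, hle⟩
  have hUE : ∀ e : 𝒢.graph.Edge, ∃ U : Subgroup (𝒢.Ge e), IsOpen (U : Set (𝒢.Ge e)) ∧
      U.index ≠ 0 ∧ U.index ≤ B ∧
      ∀ N : Subgroup (𝒢.Ge e), IsOpen (N : Set (𝒢.Ge e)) → N.index ≠ 0 → N.index ≤ K → U ≤ N := by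
    intro e
    by_cases he : e ∈ {e : 𝒢.graph.Edge | ∃ N : Subgroup (𝒢.Ge e), IsOpen (N : Set (𝒢.Ge e)) ∧
        N.index ≠ 0 ∧ N.index ≤ K ∧ ¬ fixator (F₂.SE e) ≤ N}
    · obtain ⟨U, -, hUo, hUi, hUβ, hUker⟩ := exists_open_normal_le_ker (sE e) (hsE e) K
      refine ⟨U, hUo, hUi, hUβ.trans ?_, fun N hNo hNi hNK => le_of_index_le U hUker N hNo hNi hNK⟩
      calc βE e ≤ hEE.toFinset.sup βE := Finset.le_sup (f := βE) (hEE.mem_toFinset.mpr he)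
        _ ≤ B := le_max_of_le_right (le_max_right _ _)
    · refine ⟨fixator (F₂.SE e), isOpen_fixator _, index_fixator_ne_zero _, ?_,
        fun N hNo hNi hNK => ?_⟩
      · have h2e : Nat.card (F₂.SE e).obj.V = D₂ := hD₂ (Sum.inr (Sum.inl e))
        calc (fixator (F₂.SE e)).index ≤ (Nat.card (F₂.SE e).obj.V).factorial := index_fixator_le _
          _ = D₂.factorial := by rw [h2e]
          _ ≤ B := le_max_of_le_left (le_max_right _ _)
      · by_contra hle
        exact he ⟨N, hNo, hNi, hNK, hle⟩
  choose UV hUVo hUVi hUVB hUVN using hUV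
  choose UE hUEo hUEi hUEB hUEN using hUE
  -- quasi-coherence applied to the cosets of the `U_c`
  haveI : ∀ v, (UV v).FiniteIndex := fun v => ⟨hUVi v⟩
  haveI : ∀ e, (UE e).FiniteIndex := fun e => ⟨hUEi e⟩
  obtain ⟨A, hAV, hAE⟩ := h36.isQuasiCoherent B (fun v => cosetsObj (UV v) (hUVo v) (hUVi v))
    (fun e => cosetsObj (UE e) (hUEo e) (hUEi e))
    (fun v => ⟨hUVB v, inferInstanceAs (Finite (𝒢.Gv v ⧸ UV v))⟩)
    (fun e => ⟨hUEB e, inferInstanceAs (Finite (𝒢.Ge e ⧸ UE e))⟩)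
  have hkerV : ∀ v (g : 𝒢.Gv v), A.πV v g = 1 → g ∈ UV v := fun v g hg =>
    mem_of_cosetsObj_fixed (UV v) (hUVo v) (hUVi v) g (hAV v g hg)
  have hkerE : ∀ e (g : 𝒢.Ge e), A.πE e g = 1 → g ∈ UE e := fun e g hg =>
    mem_of_cosetsObj_fixed (UE e) (hUEo e) (hUEi e) g (hAE e g hg)
  -- the trivialising covering of `A`
  obtain ⟨M, hM, hdvd⟩ := A.bounded
  refine ⟨A.trivCov hM hdvd, A.trivCov_isFinite hM hdvd, A.trivCov_hasNonemptyFibres hM hdvd,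
    fun q hq => ?_⟩
  -- at a point `q` of the component of `p`: base point in the component of `S` under `p`, degree `d`
  have hbase : S.SameComponent (S.nodeBase (S.idxNode H p)) (S.nodeBase (S.idxNode H q)) :=
    S.sameComponent_nodeBase (S.reachable_idxNode H hq)
  have hdq := hd q hq
  rcases q with ⟨⟨v, ω⟩, y⟩ | ⟨⟨e, ω⟩, y⟩
  · -- vertex point: `k ∈ Stab(x_ω)` fixing a point of the trivialising covering fixes `y`
    intro z k hz
    have hk1 : A.πV v (k : 𝒢.Gv v) = 1 := πV_eq_one_of_trivCov_ρ_eq A hM hdvd v z k hz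
    have hkU : (k : 𝒢.Gv v) ∈ UV v := hkerV v k hk1
    -- the subgroup `N'` of `k ∈ Stab` fixing `H_{(v,ω)}` pointwise is open of index `≤ K`
    let L : Subgroup (𝒢.Gv v) := BTemp.stab (S.SV v) (Quot.out ω)
    have hL : IsOpen (L : Set (𝒢.Gv v)) := (S.SV v).property.2 _
    obtain ⟨x₀⟩ := h0ne.nonempty_V v
    obtain ⟨hLi0, hLi⟩ := index_stab_le (X := S.SV v) x₀ (Quot.out ω) (h0split _ hbase)
    have hDv : Nat.card (F₀.SV v).obj.V = D := hD (Sum.inl v)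
    have hdv : Nat.card (H.SV ⟨v, ω⟩).obj.V = d := hdq
    have hN'K : (fixatorIn L (H.SV ⟨v, ω⟩)).index ≤ K := by
      rw [index_fixatorIn]
      calc (fixator (H.SV ⟨v, ω⟩)).index * L.index
          ≤ (Nat.card (H.SV ⟨v, ω⟩).obj.V).factorial * Nat.card (F₀.SV v).obj.V :=
            Nat.mul_le_mul (index_fixator_le _) hLi
        _ = K := by rw [hdv, hDv, Nat.mul_comm]
    have hN'0 : (fixatorIn L (H.SV ⟨v, ω⟩)).index ≠ 0 := by
      rw [index_fixatorIn]
      exact Nat.mul_ne_zero (index_fixator_ne_zero _) hLi0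
    have hUN' : UV v ≤ fixatorIn L (H.SV ⟨v, ω⟩) :=
      hUVN v _ (isOpen_fixatorIn L hL _) hN'0 hN'K
    have hkfix : k ∈ fixator (H.SV ⟨v, ω⟩) := (mem_fixatorIn_iff L _ k).mp (hUN' hkU)
    exact (mem_fixator_iff _ _).mp hkfix y
  · -- edge point: the same with `Π_e`
    intro z k hz
    have hk1 : A.πE e (k : 𝒢.Ge e) = 1 := πE_eq_one_of_trivCov_ρ_eq A hM hdvd e z k hz
    have hkU : (k : 𝒢.Ge e) ∈ UE e := hkerE e k hk1
    let L : Subgroup (𝒢.Ge e) := BTemp.stab (S.SE e) (Quot.out ω)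
    have hL : IsOpen (L : Set (𝒢.Ge e)) := (S.SE e).property.2 _
    obtain ⟨x₀⟩ := h0ne.nonempty_E e
    obtain ⟨hLi0, hLi⟩ := index_stab_le (X := S.SE e) x₀ (Quot.out ω) (h0split _ hbase)
    have hDe : Nat.card (F₀.SE e).obj.V = D := hD (Sum.inr (Sum.inl e))
    have hde : Nat.card (H.SE ⟨e, ω⟩).obj.V = d := hdq
    have hN'K : (fixatorIn L (H.SE ⟨e, ω⟩)).index ≤ K := by
      rw [index_fixatorIn]
      calc (fixator (H.SE ⟨e, ω⟩)).index * L.index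
          ≤ (Nat.card (H.SE ⟨e, ω⟩).obj.V).factorial * Nat.card (F₀.SE e).obj.V :=
            Nat.mul_le_mul (index_fixator_le _) hLi
        _ = K := by rw [hde, hDe, Nat.mul_comm]
    have hN'0 : (fixatorIn L (H.SE ⟨e, ω⟩)).index ≠ 0 := by
      rw [index_fixatorIn]
      exact Nat.mul_ne_zero (index_fixator_ne_zero _) hLi0
    have hUN' : UE e ≤ fixatorIn L (H.SE ⟨e, ω⟩) :=
      hUEN e _ (isOpen_fixatorIn L hL _) hN'0 hN'K
    have hkfix : k ∈ fixator (H.SE ⟨e, ω⟩) := (mem_fixatorIn_iff L _ k).mp (hUN' hkU)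
    exact (mem_fixator_iff _ _).mp hkfix y

end CovObj

/-! ### 4. Consequences: the named facts `UniformSplitting` and `EtaleOfTemperedCovering`
(Proposition 3.6 (v)) hold outright -/

/-- **The named fact `UniformSplitting` HOLDS** ([SemiAnbd] proof of Prop. 3.6 (v), p. 40: "there
exists a finite étale covering `H~ → G` whose pull-back to `G'` splits the restrictions of `H → G'` to
each of the `G'_{c'}`") — for every `G` as in Proposition 3.6 (connected, countable, Galois-countable,
quasi-coherent, totally elevated, totally aloof, verticially slim, with a vertex) that is coherent,
every tempered `S` and every finite object `H` of `B^cov(G_S)`.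
[cite: MochizukiSemiAnbd2006, Prop 3.6(v) p.40] -/
theorem uniformSplitting_holds :
    Literature.AnabelianGeometry.SemiGraphs.ProfiniteSemiGraph.UniformSplitting.{u} :=
  fun _ h36 hcoh S hS => CovObj.uniformSplittingAt_of_isCoherent S h36 hcoh hS

/-- **[SemiAnbd] Proposition 3.6 (v) HOLDS** (p. 39: "Suppose that `G` is coherent, and that we are
given a tempered covering `G' → G`. Then the resulting morphism of temperoids `B^temp(G') → B^temp(G)`
is étale"), i.e. the named fact `EtaleOfTemperedCovering`: `B^temp(G_S) ≌ B^temp(G)_S` for every `G` as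
in Prop. 3.6 that is coherent and every tempered `S`. [cite: MochizukiSemiAnbd2006, Prop 3.6(v) p.39] -/
theorem etaleOfTemperedCovering_holds :
    Literature.AnabelianGeometry.SemiGraphs.ProfiniteSemiGraph.EtaleOfTemperedCovering.{u} :=
  etaleOfTemperedCovering_of_uniformSplitting uniformSplitting_holds

namespace CovObj

variable (S : CovObj 𝒢)

/-- **Tempered over `G_S` ⇒ tempered over `G`, unconditionally** (the converse half of Prop. 3.6 (v),
print's reduction p. 40 "the composite of any tempered covering `H' → G'` with the given tempered
covering `G' → G` forms a tempered covering `H' → G`"): `isTempered_of_toCovering` with its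
`UniformSplitting` hypothesis discharged. [cite: MochizukiSemiAnbd2006, Prop 3.6(v) p.40] -/
theorem isTempered_of_toCovering' (h36 : 𝒢.Prop36Hypotheses) (hcoh : 𝒢.IsCoherent)
    (hS : S.IsTempered) (T : Over S) (hT' : (S.toCovering.obj T).IsTempered) : T.left.IsTempered :=
  S.isTempered_of_toCovering uniformSplitting_holds h36 hcoh hS T hT'

/-- **`B^temp(G_S)` and `B^temp(G)_S` have the same objects inside `B^cov(G_S) ≌ B^cov(G)_S`,
unconditionally** (`inverseImage_isTempered_eq` with `UniformSplitting` discharged).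
[cite: MochizukiSemiAnbd2006, Prop 3.6(v) p.39] -/
theorem inverseImage_isTempered_eq' (h36 : 𝒢.Prop36Hypotheses) (hcoh : 𝒢.IsCoherent)
    (hS : S.IsTempered) :
    ObjectProperty.inverseImage (fun T' : CovObj S.coveringGraph => T'.IsTempered)
        S.coveringEquiv.functor = S.temperedOver :=
  S.inverseImage_isTempered_eq uniformSplitting_holds h36 hcoh hS

end CovObj

end ProfiniteSemiGraph

end Literature.AnabelianGeometry.SemiGraphs

end
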